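import Summits.FinalStateConjecture.FinalStateConjecture.Theorems.PhotonSphereChannelsDarkFutureDefs
import Literature.Geometry.Lorentzian.Stationary
import Literature.Geometry.Lorentzian.KerrSchild
import Literature.Geometry.Lorentzian.CausalityOpennessProofs
import HarnessLib

/-!
# Horizon points lie in the black-hole region of the end (glue G3)

For an end datum `E` of a spacetime `𝓢`, the future event horizon of the end is
`E.horizon = ∂I⁻(range E.far) ∩ I⁺(range E.far)` and the black-hole region of the end is
`B = (I⁻(range E.far))ᶜ`.  Since the chronological past `I⁻(S)` of any set is open on a manifold
without boundary (O'Neill 1983, Ch. 14, Lemma 14.3; `isOpen_chronologicalPast_of_boundaryless`,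
the carrier of a `Spacetime` being modelled on the boundaryless `𝓡 4`), it is disjoint from its
own frontier, so every horizon point lies in `B`.  In particular a horizon-hull element
(`IsHorizonHullElementAlong`, whose third clause is `p ∈ E.horizon`) is a BLACK-HOLE spacetime with
respect to its end: the disjunct `(𝓢.blackHoleRegionOfEnd (range far)).Nonempty` consumed by the
stationary uniqueness statement (Chruściel–Costa, Astérisque 321 (2008), (2.3)–(2.5)).
-/

noncomputable section
set_option maxSynthPendingDepth 3
set_option linter.dupNamespace false
open Set Filter Function TopologicalSpace Manifold Bundle
open scoped Topology Manifold ContDiff ENNReal NNReal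

namespace Summit.FinalStateConjecture.FinalStateConjecture.Theorems.DarkFuture
open Literature.Geometry.Lorentzian
open Summit.FinalStateConjecture.FinalStateConjecture.Theorems.TameHull

/-- **A point of the future event horizon of an end lies in the black-hole region of that end**:
`𝓔⁺ = ∂I⁻(M_ext) ∩ I⁺(M_ext) ⊆ B = M ∖ I⁻(M_ext)`, because `I⁻(M_ext)` is open (O'Neill 1983,
Ch. 14, Lemma 14.3) and an open set misses its frontier. Chruściel–Costa, Astérisque 321 (2008),
(2.3)–(2.5); Wald 1984, §12.1. [cite: Wald1984, §12.1] -/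
theorem blackHoleRegion_nonempty_of_mem_horizon : ∀ {𝓢 : Spacetime.{0} 4} (E : EndDatum 𝓢) {p : 𝓢.carrier}, p ∈ E.horizon → p ∈ 𝓢.blackHoleRegionOfEnd (Set.range E.far) := by
  intro 𝓢 E p hp hmem
  have hopen : IsOpen (𝓢.metric.chronologicalPast 𝓢.timeOrientation (Set.range E.far)) :=
    LorentzianMetric.isOpen_chronologicalPast_of_boundaryless 𝓢.metric 𝓢.timeOrientation _
  have h := hopen.inter_frontier_eq
  exact (Set.ext_iff.1 h p).1 ⟨hmem, hp.1⟩

/-- The base point of a horizon-hull element (third clause: `p ∈ E.horizon`) lies in the black-hole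
region `B = M ∖ I⁻(range E.far)` of its end. Chruściel–Costa, Astérisque 321 (2008), (2.3)–(2.5);
Wald 1984, §12.1. [cite: Wald1984, §12.1] -/
theorem mem_blackHoleRegion_of_isHorizonHullElementAlong : ∀ {X : Type} [TopologicalSpace X] [ChartedSpace E3 X] [IsManifold (𝓡 3) ∞ X] [ConnectedSpace X] {D : InitialDataSet (𝓡 3) X} {𝒟 : VacuumCauchyDevelopment D} [𝒟.metric.HasLeviCivita] {Λ : ℕ → ℝ≥0} {r₀ : ℝ} {γ : ℝ → 𝒟.carrier} {s : ℕ → ℝ} {𝓢 : Spacetime.{0} 4} {E : EndDatum 𝓢} {p : 𝓢.carrier}, IsHorizonHullElementAlong 𝒟 Λ r₀ γ s 𝓢 E p → p ∈ 𝓢.blackHoleRegionOfEnd (Set.range E.far) :=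
  fun h ↦ blackHoleRegion_nonempty_of_mem_horizon _ h.2.2.1

/-- **A horizon-hull element is a black-hole spacetime with respect to its end**: the black-hole
region `B = M ∖ I⁻(range E.far)` of the end of a horizon-hull element is nonempty (it contains the
base point) — the black-hole disjunct of the hypotheses of the stationary uniqueness statement.
Chruściel–Costa, Astérisque 321 (2008), (2.3)–(2.5); Wald 1984, §12.1. [cite: Wald1984, §12.1] -/
theorem blackHoleRegion_nonempty_of_isHorizonHullElementAlong : ∀ {X : Type} [TopologicalSpace X] [ChartedSpace E3 X] [IsManifold (𝓡 3) ∞ X] [ConnectedSpace X] {D : InitialDataSet (𝓡 3) X} {𝒟 : VacuumCauchyDevelopment D} [𝒟.metric.HasLeviCivita] {Λ : ℕ → ℝ≥0} {r₀ : ℝ} {γ : ℝ → 𝒟.carrier} {s : ℕ → ℝ} {𝓢 : Spacetime.{0} 4} {E : EndDatum 𝓢} {p : 𝓢.carrier}, IsHorizonHullElementAlong 𝒟 Λ r₀ γ s 𝓢 E p → (𝓢.blackHoleRegionOfEnd (Set.range E.far)).Nonempty :=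
  fun h ↦ ⟨_, mem_blackHoleRegion_of_isHorizonHullElementAlong h⟩

end Summit.FinalStateConjecture.FinalStateConjecture.Theorems.DarkFuture
end
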